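import Mathlib
import HarnessLib
import Summits.HubbardSuperconductivity.HubbardSuperconductivity.Theorems.KLProgrammeKLRegimeEngineTowerMeasuredSubadditive
import Summits.HubbardSuperconductivity.HubbardSuperconductivity.Theorems.KLProgrammeKLRegimeEngineTowerRemeasureWtAbs
import Summits.HubbardSuperconductivity.HubbardSuperconductivity.Theorems.KLProgrammeKLRegimeEngineTowerRemeasureLevAbs34

/-!
# Route `KLProgramme` — crux K3 ENGINE (stmt-HubbardSuperconductivity-20437 `KLRegimeEngineV17F2`), stub (b) v2, THE LEVELS PACKAGE (ℓ), instantiation (I2):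
# THE SUMMED RE-MEASUREMENT ROWS — the measured size of a block input against the re-measured UV datum and the re-measured born increments, both
# tracks, in ABSOLUTE units (E1-LEVELS-BLUEPRINT-g8 §3 (I2) `hμ`, §6 step 3 «…EngineTowerInstRemeasure»; cell gate-hubbard-kl, seat p4 g17, count side)

E1's `klTowerMeasWt_le_remeasured_sum` / `klTowerMeasLev_le_remeasured_sum` (…EngineTowerMeasuredSubadditive) bound the measured size of the input `𝒱_{dk}` of
block `k` at `F_{dk−1}` by the supremum over pins / prescriptions of the re-measured `𝒱_0` plus, for each `k′ < k`, that of the re-measured increment `Δ_{k′}`.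
The per-summand jump rows are in the tree: k3c2-p3's relative rows with one determined leg (`klLevNormOf_klTowerIncr_remeasure_le_klEng`,
`klWtPinnedSumAt_klTowerIncr_remeasure_le_klEng_flow_deep`) and p4's absolute rows with the second conservation gain for the scale-`0` action
(`klLevNormOf_scaleZero_remeasure_le_klEng_abs/_abs34`, `klWtPinnedSumAt_scaleZero_remeasure_le_…_abs`).  This file does the remaining plumbing so that the
kit's `hμ` row is, on the model side, ONE inequality per track whose right side E1's (I6)/(I7) only has to divide by units:

* §1 weighted, rate-decoupled carrier: `klWtPinnedSumAt_klTowerInput_le` (pointwise subadditivity along `𝒱_{dk} = 𝒱_0 + Σ_{k′<k} Δ_{k′}`) and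
  **`klTowerMeasWtAt_le_of_summand_bounds`** — `klTowerMeasWtAt … d k j m ≤ V₀ + Σ_{k′<k} W k′` from per-summand bounds `V₀` (re-measured `𝒱_0`) and `W k′`;
* §2 levelled: **`klTowerMeasLev_le_of_summand_bounds`** — the same for `klTowerMeasLev … d k m F` at every level-count `F`;
* §3 **THE INCREMENT BORN AT THE COARSEST FAMILY.**  `Δ_0 = 𝒱_d − 𝒱_0` is born at `F_0` (two sectors), where the off/on-class split is vacuous exactly as for the
  UV datum (memo UV-REMEASURE-COUNT §1), so its re-measurement must also pay the ABSOLUTE count: `klLevNormOf_klTowerIncr_remeasure_le_klEng_abs/_abs34`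
  (any `k′ < k`; stated for all `k′`, load-bearing at `k′ = 0`) and the weighted `klWtPinnedSumAt_klTowerIncr_remeasure_le_of_overlap_abs` (overlap abstract) /
  `…_le_klEng_flow_deep_abs` (p3's deep window at the born block);
* §4 **THE LEVELLED `hμ` ROW IN ABSOLUTE UNITS, discharged** (binders of `stub_engine_step_norms` + the counts' thresholds; `2 ≤ d`, `1 ≤ k`, `dk − 1 ≤ nScales β + 1`):
  `klTowerMeasLev … d k (m+1) F ≤ Cuv·Φ·N₀ + C₀·Φ·klTowerBornLev … d 0 (m+1) F + Σ_{1 ≤ k′ < k} C·(2^{d(k−k′)−1})^{m−F}·klTowerBornLev … d k′ (m+1) F`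
  with `Φ = (2^{dk−1})^{(m+1) − max(F,1) − 2}` when `F + 6 ≤ m + 1` (`_abs`), `Φ = dk·(2^{dk−1})^{(m+1) − max(F,1) − 2}` when `F + 4 ≤ m + 1` (`_abs34`), and the
  relative row `Φ = (2^{dk−1})^{m−F}` at every `F` (`_lastLeg`); `N₀` bounds the level-`0` carriers `klAnisoLegKernelNormAt … klE0 0 (m+1) Ωe′` of level `F`.
The weighted track's discharge waits for the window-free general-jump overlap supplier of the located item «(I2)-WT-WINDOW» (k3c3-p2 lineage; design (X2)/(X3)):
§1 + …RemeasureWtAbs §3/§5 + §3 here are its count side, overlap constants abstract.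
Everything is proved; no definitions; nothing about the model is asserted; nothing asserts superconductivity; the dimensionless dictionary is E1's (I6)/(I7).
References: BGM 2006 §2.8 (2.76), (2.82)–(2.84), (2.88)–(2.90), (2.93)–(2.98), App. A3 [cite: BenfattoGiulianiMastropietro2006]; BGM 2003 §3.1 Lemma 3.1 (4.3) [cite: BenfattoGiulianiMastropietro2003].
-/

noncomputable section

namespace Summit.HubbardSuperconductivity.HubbardSuperconductivity.Theorems.EngineV8

set_option linter.dupNamespace false -- summit = problem name (single-conjunct summit), D-0017

open Classical
open Real Finset Literature.MathematicalPhysics.QuantumLattice Literature.Probability.LatticeModels GrassmannAlgebra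
open Literature.Probability.LatticeModels.BattleFederbush
open Literature.MathematicalPhysics.QuantumLattice.FermiRG
open Summit.HubbardSuperconductivity.HubbardSuperconductivity.Theorems.KLRegimeSplit
open Summit.HubbardSuperconductivity.HubbardSuperconductivity.Theorems.KLProgrammeLegKernels
open Summit.HubbardSuperconductivity.HubbardSuperconductivity.Theorems.DispersionFlow
open Summit.HubbardSuperconductivity.HubbardSuperconductivity.Theorems.KLRegimeWick
open Summit.HubbardSuperconductivity.HubbardSuperconductivity.Theorems.TorusFourierL2
open Summit.HubbardSuperconductivity.HubbardSuperconductivity.Theorems.PerturbedFermiCurve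

variable {L M : ℕ} [NeZero L] [NeZero M]

/-! ## §1 Weighted track, rate-decoupled carrier: subadditivity and the summed row at abstract per-summand bounds -/

omit [NeZero M] in
/-- **Pointwise form, weighted, rate-decoupled**: every rate-`j` weighted pinned sum of the input `𝒱_{dk}` at `F_{dk−1}` is at most the re-measured pinned sum of
`𝒱_0` plus those of the increments `Δ_{k′}`, `k′ < k`, all at the same family, rate and pin. -/
theorem klWtPinnedSumAt_klTowerInput_le {β : ℝ} (hβ : 0 ≤ β) (U μ : ℝ) (K : TrigPolyC4v) (d k j m : ℕ) (q : Fin m)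
    (w : SpaceTimeIdx L M × SectorLeg (sectorCount (d * k - 1))) :
    klWtPinnedSumAt L M β μ K (d * k - 1) j m (klTowerInput L M β U μ K d k) q w ≤
      klWtPinnedSumAt L M β μ K (d * k - 1) j m (klEffectiveAction L M β U μ K klE0 0) q w +
        ∑ k' ∈ range k, klWtPinnedSumAt L M β μ K (d * k - 1) j m (klTowerIncr L M β U μ K d k') q w := by
  rw [klTowerInput_eq_zero_add_sum]
  exact (klWtPinnedSumAt_add_le hβ μ K _ j m _ _ q w).trans (by gcongr; exact klWtPinnedSumAt_sum_le hβ μ K _ j m _ _ q w)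

omit [NeZero M] in
/-- **THE SUMMED ROW, weighted track, abstract per-summand bounds.**  If every rate-`j` pinned sum of `𝒱_0` re-measured at `F_{dk−1}` is `≤ V₀` and, for each
`k′ < k`, every rate-`j` pinned sum of `Δ_{k′}` re-measured there is `≤ W k′`, then `klTowerMeasWtAt … d k j m ≤ V₀ + Σ_{k′<k} W k′`. -/
theorem klTowerMeasWtAt_le_of_summand_bounds {β : ℝ} (hβ : 0 ≤ β) (U μ : ℝ) (K : TrigPolyC4v) (d k j m : ℕ) {V₀ : ℝ} {W : ℕ → ℝ}
    (hV0 : 0 ≤ V₀) (hW0 : ∀ k' < k, 0 ≤ W k')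
    (hV : ∀ (q : Fin m) (w : SpaceTimeIdx L M × SectorLeg (sectorCount (d * k - 1))),
      klWtPinnedSumAt L M β μ K (d * k - 1) j m (klEffectiveAction L M β U μ K klE0 0) q w ≤ V₀)
    (hW : ∀ k' < k, ∀ (q : Fin m) (w : SpaceTimeIdx L M × SectorLeg (sectorCount (d * k - 1))),
      klWtPinnedSumAt L M β μ K (d * k - 1) j m (klTowerIncr L M β U μ K d k') q w ≤ W k') :
    klTowerMeasWtAt L M β U μ K d k j m ≤ V₀ + ∑ k' ∈ range k, W k' := by
  have hRHS : 0 ≤ V₀ + ∑ k' ∈ range k, W k' := add_nonneg hV0 (sum_nonneg fun k' hk' => hW0 k' (mem_range.1 hk'))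
  unfold klTowerMeasWtAt
  rcases isEmpty_or_nonempty (Fin m × (SpaceTimeIdx L M × SectorLeg (sectorCount (d * k - 1)))) with h | h
  · rw [Real.iSup_of_isEmpty]; exact hRHS
  · exact ciSup_le fun qw => (klWtPinnedSumAt_klTowerInput_le hβ U μ K d k j m qw.1 qw.2).trans
      (add_le_add (hV qw.1 qw.2) (sum_le_sum fun k' hk' => hW k' (mem_range.1 hk') qw.1 qw.2))

/-! ## §2 Levelled track: the summed row at abstract per-summand bounds -/

omit [NeZero M] in
/-- **THE SUMMED ROW, levelled track, abstract per-summand bounds.**  If at every prescription of level-count `F` the levelled norm of `𝒱_0` re-measured at `F_{dk−1}`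
is `≤ V₀` and that of `Δ_{k′}` (`k′ < k`) is `≤ W k′`, then `klTowerMeasLev … d k m F ≤ V₀ + Σ_{k′<k} W k′`. -/
theorem klTowerMeasLev_le_of_summand_bounds {β : ℝ} (hβ : 0 ≤ β) (U μ : ℝ) (K : TrigPolyC4v) (d k m F : ℕ) {V₀ : ℝ} {W : ℕ → ℝ}
    (hV0 : 0 ≤ V₀) (hW0 : ∀ k' < k, 0 ≤ W k')
    (hV : ∀ Ωe : Fin m → Option (SectorLeg (sectorCount (d * k - 1))), levelCount Ωe = F →
      klLevNormOf L M β μ K (d * k - 1) m (klEffectiveAction L M β U μ K klE0 0) Ωe ≤ V₀)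
    (hW : ∀ k' < k, ∀ Ωe : Fin m → Option (SectorLeg (sectorCount (d * k - 1))), levelCount Ωe = F →
      klLevNormOf L M β μ K (d * k - 1) m (klTowerIncr L M β U μ K d k') Ωe ≤ W k') :
    klTowerMeasLev L M β U μ K d k m F ≤ V₀ + ∑ k' ∈ range k, W k' := by
  have hRHS : 0 ≤ V₀ + ∑ k' ∈ range k, W k' := add_nonneg hV0 (sum_nonneg fun k' hk' => hW0 k' (mem_range.1 hk'))
  unfold klTowerMeasLev
  rcases isEmpty_or_nonempty {Ωe : Fin m → Option (SectorLeg (sectorCount (d * k - 1))) // levelCount Ωe = F} with h | h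
  · rw [Real.iSup_of_isEmpty]; exact hRHS
  · exact ciSup_le fun Ωe => (klLevNormOf_klTowerInput_le hβ U μ K d k m Ωe.1).trans
      (add_le_add (hV Ωe.1 Ωe.2) (sum_le_sum fun k' hk' => hW k' (mem_range.1 hk') Ωe.1 Ωe.2))

/-! ## §3 An increment re-measured with the ABSOLUTE count (load-bearing for `Δ_0`, born at the coarsest family `F_0`) -/

/-- **THE INCREMENT `Δ_{k′}` RE-MEASURED AT `F_{dk−1}` WITH THE SECOND CONSERVATION GAIN, levelled** (`k′ < k`, `2 ≤ d`, `dk − 1 ≤ nScales β + 1`; binders of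
`klLevNormOf_jump_le_klEng_abs`): at every prescription `Ωe` with `levelCount Ωe + 6 ≤ m + 1`,
`klLevNormOf … (dk−1) (m+1) Δ_{k′} Ωe ≤ C_m·(2^{dk−1})^{(m+1) − max(levelCount Ωe, 1) − 2}·klTowerBornLev … d k′ (m+1) (levelCount Ωe)` — ABSOLUTE in the fine family;
for `k′ = 0` (`Δ_0` is born at `F_0`, where the off/on-class split is vacuous) this is THE row, for `k′ ≥ 1` the relative rows are usually sharper.
[cite: BenfattoGiulianiMastropietro2006, §2.8 (2.82)-(2.84), (2.88)-(2.90); BenfattoGiulianiMastropietro2003, §3.1 Lemma 3.1 (4.3)] -/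
theorem klLevNormOf_klTowerIncr_remeasure_le_klEng_abs (m : ℕ) :
    ∃ C : ℝ, 0 < C ∧ ∀ R : RenConsts, R.WF2 → ∃ c₃' : ℝ, 0 < c₃' ∧ ∃ U₀' : ℝ, 0 < U₀' ∧
      ∀ (P : SplitConsts) (c : ℝ), P.WF → 0 < c → c ≤ klEngC₃6 P R → c ≤ c₃' →
      ∀ μ ∈ klWindowC, ∀ U : ℝ, 0 < U → U ≤ klEngU₀9 P R c → U ≤ U₀' → ∀ β : ℝ, klBetaMin ≤ β → β ≤ Real.exp (c / U ^ 2) →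
      ∀ K : TrigPolyC4v, FrameOK R U (nScales β) μ K → ∀ (L M : ℕ) [NeZero L] [NeZero M],
      klEngL₃ β U ≤ L → klEngM₃ β U L ≤ M → ∀ d k k' : ℕ, 2 ≤ d → k' < k → d * k - 1 ≤ nScales β + 1 →
      ∀ Ωe : Fin (m + 1) → Option (SectorLeg (sectorCount (d * k - 1))), levelCount Ωe + 6 ≤ m + 1 →
        klLevNormOf L M β μ K (d * k - 1) (m + 1) (klTowerIncr L M β U μ K d k') Ωe ≤
          C * ((2 : ℝ) ^ (d * k - 1)) ^ ((m + 1) - max (levelCount Ωe) 1 - 2) * klTowerBornLev L M β U μ K d k' (m + 1) (levelCount Ωe) := by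
  obtain ⟨C, hC, h⟩ := klLevNormOf_jump_le_klEng_abs m
  refine ⟨C, hC, fun R hR2 => ?_⟩
  obtain ⟨c₃, hc₃, U₀, hU₀, h'⟩ := h R hR2
  refine ⟨c₃, hc₃, U₀, hU₀, ?_⟩
  intro P c hP hc hc6 hc₃' μ hμ U hU hU9 hU₀' β hβmin hβc K hK L M _ _ hL3 hM3 d k k' hd hk hkN Ωe hlev
  have hβ : 0 < β := KLRegimeSplit.pos_of_klBetaMin_le hβmin
  exact h' P c hP hc hc6 hc₃' μ hμ U hU hU9 hU₀' β hβmin hβc K hK L M hL3 hM3 (d * k') (d * k - 1) (block_jump_le hd hk) hkN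
    (klTowerIncr L M β U μ K d k') (fun m' X hX => klTowerIncr_momentumConserving β U μ K d k' m' X hX) Ωe hlev
    (klTowerBornLev L M β U μ K d k' (m + 1) (levelCount Ωe)) (klTowerBornLev_nonneg hβ.le U μ K d k' (m + 1) _)
    (fun Ωe' hlev' => by rw [← hlev']; exact klLevNormOf_le_klTowerBornLev β U μ K d k' (m + 1) Ωe')

/-- **THE INCREMENT `Δ_{k′}` RE-MEASURED AT `F_{dk−1}` WITH THE SECOND CONSERVATION GAIN, levelled, 3–4 free legs** (`levelCount Ωe + 4 ≤ m + 1`; one factor `dk`):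
`klLevNormOf … (dk−1) (m+1) Δ_{k′} Ωe ≤ C_m·((dk−1)+1)·(2^{dk−1})^{(m+1) − max(levelCount Ωe, 1) − 2}·klTowerBornLev … d k′ (m+1) (levelCount Ωe)`.
[cite: BenfattoGiulianiMastropietro2006, §2.8 (2.82)-(2.84), (2.88)-(2.90); BenfattoGiulianiMastropietro2003, §3.1 Lemma 3.1 (4.3)] -/
theorem klLevNormOf_klTowerIncr_remeasure_le_klEng_abs34 (m : ℕ) :
    ∃ C : ℝ, 0 < C ∧ ∀ R : RenConsts, R.WF2 → ∃ c₃' : ℝ, 0 < c₃' ∧ ∃ U₀' : ℝ, 0 < U₀' ∧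
      ∀ (P : SplitConsts) (c : ℝ), P.WF → 0 < c → c ≤ klEngC₃6 P R → c ≤ c₃' →
      ∀ μ ∈ klWindowC, ∀ U : ℝ, 0 < U → U ≤ klEngU₀9 P R c → U ≤ U₀' → ∀ β : ℝ, klBetaMin ≤ β → β ≤ Real.exp (c / U ^ 2) →
      ∀ K : TrigPolyC4v, FrameOK R U (nScales β) μ K → ∀ (L M : ℕ) [NeZero L] [NeZero M],
      klEngL₃ β U ≤ L → klEngM₃ β U L ≤ M → ∀ d k k' : ℕ, 2 ≤ d → k' < k → d * k - 1 ≤ nScales β + 1 →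
      ∀ Ωe : Fin (m + 1) → Option (SectorLeg (sectorCount (d * k - 1))), levelCount Ωe + 4 ≤ m + 1 →
        klLevNormOf L M β μ K (d * k - 1) (m + 1) (klTowerIncr L M β U μ K d k') Ωe ≤
          C * (((d * k - 1 : ℕ) : ℝ) + 1) * ((2 : ℝ) ^ (d * k - 1)) ^ ((m + 1) - max (levelCount Ωe) 1 - 2) *
            klTowerBornLev L M β U μ K d k' (m + 1) (levelCount Ωe) := by
  obtain ⟨C, hC, h⟩ := klLevNormOf_jump_le_klEng_abs34 m
  refine ⟨C, hC, fun R hR2 => ?_⟩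
  obtain ⟨c₃, hc₃, U₀, hU₀, h'⟩ := h R hR2
  refine ⟨c₃, hc₃, U₀, hU₀, ?_⟩
  intro P c hP hc hc6 hc₃' μ hμ U hU hU9 hU₀' β hβmin hβc K hK L M _ _ hL3 hM3 d k k' hd hk hkN Ωe hlev
  have hβ : 0 < β := KLRegimeSplit.pos_of_klBetaMin_le hβmin
  exact h' P c hP hc hc6 hc₃' μ hμ U hU hU9 hU₀' β hβmin hβc K hK L M hL3 hM3 (d * k') (d * k - 1) (block_jump_le hd hk) hkN
    (klTowerIncr L M β U μ K d k') (fun m' X hX => klTowerIncr_momentumConserving β U μ K d k' m' X hX) Ωe hlev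
    (klTowerBornLev L M β U μ K d k' (m + 1) (levelCount Ωe)) (klTowerBornLev_nonneg hβ.le U μ K d k' (m + 1) _)
    (fun Ωe' hlev' => by rw [← hlev']; exact klLevNormOf_le_klTowerBornLev β U μ K d k' (m + 1) Ωe')

/-- **THE INCREMENT `Δ_{k′}` RE-MEASURED AT `F_{dk−1}` WITH THE SECOND CONSERVATION GAIN, weighted track, OVERLAP ABSTRACT** (`k′ < k`, `2 ≤ d`, any rate `j`;
count discharged as in `klWtPinnedSumAt_jump_le_of_overlap_abs`, the pair-weighted overlap constants `c₁, c₁r` of `‖E(klAnisoFamily (dk−1))·S(F̃_{dk′})‖` at rate `j`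
supplied by the caller): for `5 ≤ m`, `klWtPinnedSumAt … (dk−1) j (m+1) Δ_{k′} q w ≤ c₁^m·c₁r·ε^{m+1}·(D^{m+1}·27^{m+1})·(2^{dk−1})^{m−2}·klTowerBornWtAt … d k′ j (m+1)`.
[cite: BenfattoGiulianiMastropietro2006, §2.8 (2.82)-(2.84), (2.88)-(2.90); BenfattoGiulianiMastropietro2003, §3.1 Lemma 3.1 (4.3), §7.4] -/
theorem klWtPinnedSumAt_klTowerIncr_remeasure_le_of_overlap_abs :
    ∃ D : ℝ, 0 < D ∧ ∀ R : RenConsts, (∀ j, 0 ≤ R.Gfr j) → ∃ c₃' : ℝ, 0 < c₃' ∧ ∃ U₀' : ℝ, 0 < U₀' ∧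
      ∀ c : ℝ, 0 < c → c ≤ c₃' → ∀ U : ℝ, 0 < U → U ≤ U₀' → ∀ β : ℝ, klBetaMin ≤ β → β ≤ Real.exp (c / U ^ 2) →
      ∀ μ ∈ klWindowC, ∀ (ν : ℝ) (K : TrigPolyC4v), FrameOK R U (nScales β) ν K →
      ∀ (L M : ℕ) [NeZero L] [NeZero M] (d k k' : ℕ), 2 ≤ d → k' < k →
      ∀ (j : ℕ) (c₁ c₁r : ℝ), 0 ≤ c₁ → 0 ≤ c₁r →
        (∀ (ω'' : Fin (sectorCount (d * k - 1))) (ω' : Fin (sectorCount (d * k'))) (σ c : Fin 2) (x' : SpaceTimeIdx L M),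
          ∑ x'' : SpaceTimeIdx L M, ‖(sectorAnalysisMatrix L M β (klAnisoFamily L M β μ K klE0 (d * k - 1)) *
            sectorSubMatrix L M β (bgmFatMultiplier L M klE0 β (nambuXiCT L μ K) (d * k'))) (x'', ((ω'', σ), c)) (x', ((ω', σ), c))‖ *
              klScaleWt L M β j
                {latticeLegPos (2 * (2 * M)) ((x'', ((ω'', σ), c)) : SpaceTimeIdx L M × SectorLeg (sectorCount (d * k - 1))),
                  latticeLegPos (2 * (2 * M)) ((x', ((ω', σ), c)) : SpaceTimeIdx L M × SectorLeg (sectorCount (d * k')))} ≤ c₁) →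
        (∀ (ω'' : Fin (sectorCount (d * k - 1))) (ω' : Fin (sectorCount (d * k'))) (σ c : Fin 2) (x'' : SpaceTimeIdx L M),
          ∑ x' : SpaceTimeIdx L M, ‖(sectorAnalysisMatrix L M β (klAnisoFamily L M β μ K klE0 (d * k - 1)) *
            sectorSubMatrix L M β (bgmFatMultiplier L M klE0 β (nambuXiCT L μ K) (d * k'))) (x'', ((ω'', σ), c)) (x', ((ω', σ), c))‖ *
              klScaleWt L M β j
                {latticeLegPos (2 * (2 * M)) ((x'', ((ω'', σ), c)) : SpaceTimeIdx L M × SectorLeg (sectorCount (d * k - 1))),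
                  latticeLegPos (2 * (2 * M)) ((x', ((ω', σ), c)) : SpaceTimeIdx L M × SectorLeg (sectorCount (d * k')))} ≤ c₁r) →
      ∀ m : ℕ, 5 ≤ m → ∀ (q : Fin (m + 1)) (w : SpaceTimeIdx L M × SectorLeg (sectorCount (d * k - 1))),
        klWtPinnedSumAt L M β μ K (d * k - 1) j (m + 1) (klTowerIncr L M β U μ K d k') q w ≤
          c₁ ^ m * c₁r * imagTimeWeight β M ^ (m + 1) * (D ^ (m + 1) * 27 ^ (m + 1)) * ((2 : ℝ) ^ (d * k - 1)) ^ (m - 2) *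
            klTowerBornWtAt L M β U μ K d k' j (m + 1) := by
  obtain ⟨D, hD, hreg⟩ := klWtPinnedSumAt_jump_le_of_overlap_abs
  refine ⟨D, hD, fun R hRj => ?_⟩
  obtain ⟨c₃, hc₃, U₀, hU₀, h⟩ := hreg R hRj
  refine ⟨c₃, hc₃, U₀, hU₀, ?_⟩
  intro c hc hc₃' U hU hU₀' β hβmin hβc μ hμ ν K hK L M _ _ d k k' hd hk j c₁ c₁r hc₁0 hc₁r0 hcol₁ hrow₁ m hm q w
  have hβ : 0 < β := KLRegimeSplit.pos_of_klBetaMin_le hβmin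
  exact h c hc hc₃' U hU hU₀' β hβmin hβc μ hμ ν K hK L M (d * k') (d * k - 1) (block_jump_le hd hk) (klTowerIncr L M β U μ K d k')
    (fun m' X hX => klTowerIncr_momentumConserving β U μ K d k' m' X hX) j c₁ c₁r hc₁0 hc₁r0 hcol₁ hrow₁ m hm q w
    (klTowerBornWtAt L M β U μ K d k' j (m + 1)) (klTowerBornWtAt_nonneg hβ.le U μ K d k' j (m + 1))
    (fun w' => klWtPinnedSumAt_le_klTowerBornWtAt β U μ K d k' j (m + 1) q w')

/-- **THE INCREMENT `Δ_{k′}` RE-MEASURED AT `F_{dk−1}` WITH THE SECOND CONSERVATION GAIN, weighted track, flow frame, p3's deep window at the BORN block**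
(`k′ < k`, `2 ≤ d`, `dk − 1 ≤ n`, `4ⁿ·U ≤ 4^{2(dk′+1)+dd}`, rate `j ≥ dk − 1`, `5 ≤ m`): drop-in twin of `klWtPinnedSumAt_klTowerIncr_remeasure_le_klEng_flow_deep`
with exponent `m − 2` on the ABSOLUTE fine count `2^{dk−1}` — sharper than the relative row exactly when `dk′ < (dk−1)/(m−1)`-ish, in particular at `k′ = 0`.
[cite: BenfattoGiulianiMastropietro2006, §2.8 (2.82)-(2.84), (2.88)-(2.90); BenfattoGiulianiMastropietro2003, §3.1 Lemma 3.1 (4.3)] -/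
theorem klWtPinnedSumAt_klTowerIncr_remeasure_le_klEng_flow_deep_abs (dd m : ℕ) (hm : 5 ≤ m) :
    ∃ C : ℝ, 0 < C ∧ ∀ R : RenConsts, R.WF2 → ∃ c₃' : ℝ, 0 < c₃' ∧ ∃ U₀' : ℝ, 0 < U₀' ∧
      ∀ (G : GeoConsts) (P : SplitConsts) (Q : EngConsts) (cc : ℝ), 0 < cc → cc ≤ klEngC₃6 P R → cc ≤ c₃' →
      ∀ μ ∈ klWindowC, ∀ U : ℝ, 0 < U → U ≤ min (klEngU₀3 P R cc) (1 / (R.Gfr 3 + 1)) → U ≤ U₀' →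
      ∀ β : ℝ, klBetaMin ≤ β → β ≤ Real.exp (cc / U ^ 2) →
      ∀ (L M : ℕ) [NeZero L] [NeZero M], klEngL₃ β U ≤ L → klEngM₃ β U L ≤ M →
      ∀ n : ℕ, 1 ≤ n → n ≤ nScales β + 1 →
        HistP klPredsV17F2 L M G P Q R β U μ 0 n → FrameOK R U (nScales β) μ (klFlowFrameU L M β U μ n) →
        ∀ d k k' : ℕ, 2 ≤ d → k' < k → d * k - 1 ≤ n → (4 : ℝ) ^ n * U ≤ (4 : ℝ) ^ (2 * (d * k' + 1) + dd) →
        ∀ j : ℕ, d * k - 1 ≤ j → ∀ (q : Fin (m + 1)) (w : SpaceTimeIdx L M × SectorLeg (sectorCount (d * k - 1))),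
          klWtPinnedSumAt L M β μ (klFlowFrameU L M β U μ n) (d * k - 1) j (m + 1)
              (klTowerIncr L M β U μ (klFlowFrameU L M β U μ n) d k') q w ≤
            C * ((2 : ℝ) ^ (d * k - 1)) ^ (m - 2) * klTowerBornWtAt L M β U μ (klFlowFrameU L M β U μ n) d k' j (m + 1) := by
  obtain ⟨C, hC, h⟩ := klWtPinnedSumAt_jump_le_klEng_flow_deep_abs dd m hm
  refine ⟨C, hC, fun R hR2 => ?_⟩
  obtain ⟨c₃, hc₃, U₀, hU₀, h'⟩ := h R hR2
  refine ⟨c₃, hc₃, U₀, hU₀, ?_⟩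
  intro G P Q cc hcc hcc6 hcc₃' μ hμ U hU hUle hU₀' β hβmin hβc L M _ _ hL3 hM3 n hn1 hnN hhist hfr d k k' hd hk hkn hwin j hj q w
  have hβ : 0 < β := KLRegimeSplit.pos_of_klBetaMin_le hβmin
  exact h' G P Q cc hcc hcc6 hcc₃' μ hμ U hU hUle hU₀' β hβmin hβc L M hL3 hM3 n hn1 hnN hhist hfr (d * k') (d * k - 1) (block_jump_le hd hk) hkn
    hwin (klTowerIncr L M β U μ _ d k') (fun m' X hX => klTowerIncr_momentumConserving β U μ _ d k' m' X hX) j hj q w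
    (klTowerBornWtAt L M β U μ _ d k' j (m + 1)) (klTowerBornWtAt_nonneg hβ.le U μ _ d k' j (m + 1))
    (fun w' => klWtPinnedSumAt_le_klTowerBornWtAt β U μ _ d k' j (m + 1) q w')

/-! ## §4 The levelled `hμ` row in absolute units, discharged -/

/-- **THE LEVELLED `hμ` ROW IN ABSOLUTE UNITS, ≥ 5 free legs** (`F + 6 ≤ m + 1`; `2 ≤ d`, `1 ≤ k`, `dk − 1 ≤ nScales β + 1`; binders of `stub_engine_step_norms` + the
counts' thresholds): with `N := 2^{dk−1}` and `Φ := N^{(m+1) − max(F,1) − 2}`,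
`klTowerMeasLev … d k (m+1) F ≤ Cuv·Φ·N₀ + C₀·Φ·klTowerBornLev … d 0 (m+1) F + Σ_{k′ ∈ [1,k)} C·(2^{dk−1−dk′})^{m−F}·klTowerBornLev … d k′ (m+1) F`
whenever the level-`0` carriers of level `F` are `≤ N₀` — the UV datum and `Δ_0` (both born at `F_0`) with the second conservation gain, the thin-born increments with
the relative row. [cite: BenfattoGiulianiMastropietro2006, §2.8 (2.76), (2.82)-(2.84), (2.93)-(2.98); BenfattoGiulianiMastropietro2003, §3.1 Lemma 3.1 (4.3)] -/
theorem klTowerMeasLev_le_uv_add_sum_bornLev_klEng_abs (m : ℕ) :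
    ∃ Cuv : ℝ, 0 < Cuv ∧ ∃ C₀ : ℝ, 0 < C₀ ∧ ∃ C : ℝ, 0 < C ∧ ∀ R : RenConsts, R.WF2 → ∃ c₃' : ℝ, 0 < c₃' ∧ ∃ U₀' : ℝ, 0 < U₀' ∧
      ∀ (P : SplitConsts) (c : ℝ), P.WF → 0 < c → c ≤ klEngC₃6 P R → c ≤ c₃' →
      ∀ μ ∈ klWindowC, ∀ U : ℝ, 0 < U → U ≤ klEngU₀9 P R c → U ≤ U₀' → ∀ β : ℝ, klBetaMin ≤ β → β ≤ Real.exp (c / U ^ 2) →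
      ∀ K : TrigPolyC4v, FrameOK R U (nScales β) μ K → ∀ (L M : ℕ) [NeZero L] [NeZero M],
      klEngL₃ β U ≤ L → klEngM₃ β U L ≤ M → ∀ d k : ℕ, 2 ≤ d → 1 ≤ k → d * k - 1 ≤ nScales β + 1 →
      ∀ F : ℕ, F + 6 ≤ m + 1 → ∀ N₀ : ℝ, 0 ≤ N₀ →
        (∀ Ωe' : Fin (m + 1) → Option (SectorLeg (sectorCount 0)), levelCount Ωe' = F →
          klAnisoLegKernelNormAt L M β U μ K klE0 0 (m + 1) Ωe' ≤ N₀) →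
        klTowerMeasLev L M β U μ K d k (m + 1) F ≤
          Cuv * ((2 : ℝ) ^ (d * k - 1)) ^ ((m + 1) - max F 1 - 2) * N₀ +
            (C₀ * ((2 : ℝ) ^ (d * k - 1)) ^ ((m + 1) - max F 1 - 2) * klTowerBornLev L M β U μ K d 0 (m + 1) F +
              ∑ k' ∈ Ico 1 k, C * ((2 : ℝ) ^ (d * k - 1 - d * k')) ^ (m - F) * klTowerBornLev L M β U μ K d k' (m + 1) F) := by
  obtain ⟨Cuv, hCuv, huv⟩ := klLevNormOf_scaleZero_remeasure_le_klEng_abs m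
  obtain ⟨C₀, hC₀, h0⟩ := klLevNormOf_klTowerIncr_remeasure_le_klEng_abs m
  obtain ⟨C, hC, hrel⟩ := klLevNormOf_klTowerIncr_remeasure_le_klEng m
  refine ⟨Cuv, hCuv, C₀, hC₀, C, hC, fun R hR2 => ?_⟩
  obtain ⟨c₁', hc₁', U₁', hU₁', huv'⟩ := huv R hR2
  obtain ⟨c₂', hc₂', U₂', hU₂', h0'⟩ := h0 R hR2
  obtain ⟨c₃', hc₃', U₃', hU₃', hrel'⟩ := hrel R hR2
  refine ⟨min c₁' (min c₂' c₃'), by positivity, min U₁' (min U₂' U₃'), by positivity, ?_⟩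
  intro P c hP hc hc6 hcmin μ hμ U hU hU9 hUmin β hβmin hβc K hK L M _ _ hL3 hM3 d k hd hk1 hkN F hF N₀ hN0 hN
  have hβ : 0 < β := KLRegimeSplit.pos_of_klBetaMin_le hβmin
  obtain ⟨hc₁, hc₂, hc₃⟩ : c ≤ c₁' ∧ c ≤ c₂' ∧ c ≤ c₃' := by simp only [le_min_iff] at hcmin; exact ⟨hcmin.1, hcmin.2.1, hcmin.2.2⟩
  obtain ⟨hU₁, hU₂, hU₃⟩ : U ≤ U₁' ∧ U ≤ U₂' ∧ U ≤ U₃' := by simp only [le_min_iff] at hUmin; exact ⟨hUmin.1, hUmin.2.1, hUmin.2.2⟩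
  have hJ1 : 1 ≤ d * k - 1 := by have : 2 * 1 ≤ d * k := Nat.mul_le_mul hd hk1; omega
  set N : ℝ := ((2 : ℝ) ^ (d * k - 1)) with hNdef
  set Φ : ℝ := N ^ ((m + 1) - max F 1 - 2) with hΦ
  have hΦ0 : 0 ≤ Φ := by positivity
  -- the summand bounds
  set W : ℕ → ℝ := fun k' => if k' = 0 then C₀ * Φ * klTowerBornLev L M β U μ K d 0 (m + 1) F
    else C * ((2 : ℝ) ^ (d * k - 1 - d * k')) ^ (m - F) * klTowerBornLev L M β U μ K d k' (m + 1) F with hW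
  have hW0 : ∀ k' < k, 0 ≤ W k' := by
    intro k' _
    by_cases hk' : k' = 0
    · simp only [hW, hk', if_true]; exact mul_nonneg (by positivity) (klTowerBornLev_nonneg hβ.le U μ K d 0 (m + 1) F)
    · simp only [hW, hk', if_false]; exact mul_nonneg (by positivity) (klTowerBornLev_nonneg hβ.le U μ K d k' (m + 1) F)
  have hmain := klTowerMeasLev_le_of_summand_bounds (L := L) (M := M) hβ.le U μ K d k (m + 1) F (V₀ := Cuv * Φ * N₀) (W := W)
    (by positivity) hW0
    (fun Ωe hlev => by
      have h := huv' P c hP hc hc6 hc₁ μ hμ U hU hU9 hU₁ β hβmin hβc K hK L M hL3 hM3 (d * k - 1) hJ1 hkN Ωe (by omega) N₀ hN0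
        (fun Ωe' hlev' => hN Ωe' (hlev'.trans hlev))
      rw [hlev] at h; exact h)
    (fun k' hk' Ωe hlev => by
      by_cases hk'0 : k' = 0
      · subst hk'0
        have h := h0' P c hP hc hc6 hc₂ μ hμ U hU hU9 hU₂ β hβmin hβc K hK L M hL3 hM3 d k 0 hd hk' hkN Ωe (by omega)
        rw [hlev] at h; simpa only [hW, if_true] using h
      · have h := hrel' P c hP hc hc6 hc₃ μ hμ U hU hU9 hU₃ β hβmin hβc K hK L M hL3 hM3 d k k' hd hk' hkN Ωe
        rw [hlev] at h; simpa only [hW, hk'0, if_false] using h)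
  -- split the sum at `k′ = 0`
  have hsplit : ∑ k' ∈ range k, W k' = W 0 + ∑ k' ∈ Ico 1 k, W k' := by rw [range_eq_Ico]; exact sum_eq_sum_Ico_succ_bot hk1 W
  have hW0eq : W 0 = C₀ * Φ * klTowerBornLev L M β U μ K d 0 (m + 1) F := by simp [hW]
  have hWpos : ∑ k' ∈ Ico 1 k, W k' = ∑ k' ∈ Ico 1 k, C * ((2 : ℝ) ^ (d * k - 1 - d * k')) ^ (m - F) * klTowerBornLev L M β U μ K d k' (m + 1) F := by
    refine sum_congr rfl fun k' hk' => ?_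
    have hk'1 : k' ≠ 0 := by have := (mem_Ico.1 hk').1; omega
    simp [hW, hk'1]
  calc klTowerMeasLev L M β U μ K d k (m + 1) F ≤ Cuv * Φ * N₀ + ∑ k' ∈ range k, W k' := hmain
    _ = Cuv * Φ * N₀ + (C₀ * Φ * klTowerBornLev L M β U μ K d 0 (m + 1) F +
          ∑ k' ∈ Ico 1 k, C * ((2 : ℝ) ^ (d * k - 1 - d * k')) ^ (m - F) * klTowerBornLev L M β U μ K d k' (m + 1) F) := by
        rw [hsplit, hW0eq, hWpos]

/-- **THE LEVELLED `hμ` ROW IN ABSOLUTE UNITS, 3–4 free legs** (`F + 4 ≤ m + 1`; one factor `dk = (dk−1)+1` on the two `F_0`-born summands):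
`klTowerMeasLev … d k (m+1) F ≤ Cuv·dk·Φ·N₀ + C₀·dk·Φ·klTowerBornLev … d 0 (m+1) F + Σ_{k′ ∈ [1,k)} C·(2^{dk−1−dk′})^{m−F}·klTowerBornLev … d k′ (m+1) F`, `Φ` as above.
[cite: BenfattoGiulianiMastropietro2006, §2.8 (2.76), (2.82)-(2.84), (2.93)-(2.98); BenfattoGiulianiMastropietro2003, §3.1 Lemma 3.1 (4.3)] -/
theorem klTowerMeasLev_le_uv_add_sum_bornLev_klEng_abs34 (m : ℕ) :
    ∃ Cuv : ℝ, 0 < Cuv ∧ ∃ C₀ : ℝ, 0 < C₀ ∧ ∃ C : ℝ, 0 < C ∧ ∀ R : RenConsts, R.WF2 → ∃ c₃' : ℝ, 0 < c₃' ∧ ∃ U₀' : ℝ, 0 < U₀' ∧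
      ∀ (P : SplitConsts) (c : ℝ), P.WF → 0 < c → c ≤ klEngC₃6 P R → c ≤ c₃' →
      ∀ μ ∈ klWindowC, ∀ U : ℝ, 0 < U → U ≤ klEngU₀9 P R c → U ≤ U₀' → ∀ β : ℝ, klBetaMin ≤ β → β ≤ Real.exp (c / U ^ 2) →
      ∀ K : TrigPolyC4v, FrameOK R U (nScales β) μ K → ∀ (L M : ℕ) [NeZero L] [NeZero M],
      klEngL₃ β U ≤ L → klEngM₃ β U L ≤ M → ∀ d k : ℕ, 2 ≤ d → 1 ≤ k → d * k - 1 ≤ nScales β + 1 →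
      ∀ F : ℕ, F + 4 ≤ m + 1 → ∀ N₀ : ℝ, 0 ≤ N₀ →
        (∀ Ωe' : Fin (m + 1) → Option (SectorLeg (sectorCount 0)), levelCount Ωe' = F →
          klAnisoLegKernelNormAt L M β U μ K klE0 0 (m + 1) Ωe' ≤ N₀) →
        klTowerMeasLev L M β U μ K d k (m + 1) F ≤
          Cuv * (((d * k - 1 : ℕ) : ℝ) + 1) * ((2 : ℝ) ^ (d * k - 1)) ^ ((m + 1) - max F 1 - 2) * N₀ +
            (C₀ * (((d * k - 1 : ℕ) : ℝ) + 1) * ((2 : ℝ) ^ (d * k - 1)) ^ ((m + 1) - max F 1 - 2) * klTowerBornLev L M β U μ K d 0 (m + 1) F +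
              ∑ k' ∈ Ico 1 k, C * ((2 : ℝ) ^ (d * k - 1 - d * k')) ^ (m - F) * klTowerBornLev L M β U μ K d k' (m + 1) F) := by
  obtain ⟨Cuv, hCuv, huv⟩ := klLevNormOf_scaleZero_remeasure_le_klEng_abs34 m
  obtain ⟨C₀, hC₀, h0⟩ := klLevNormOf_klTowerIncr_remeasure_le_klEng_abs34 m
  obtain ⟨C, hC, hrel⟩ := klLevNormOf_klTowerIncr_remeasure_le_klEng m
  refine ⟨Cuv, hCuv, C₀, hC₀, C, hC, fun R hR2 => ?_⟩
  obtain ⟨c₁', hc₁', U₁', hU₁', huv'⟩ := huv R hR2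
  obtain ⟨c₂', hc₂', U₂', hU₂', h0'⟩ := h0 R hR2
  obtain ⟨c₃', hc₃', U₃', hU₃', hrel'⟩ := hrel R hR2
  refine ⟨min c₁' (min c₂' c₃'), by positivity, min U₁' (min U₂' U₃'), by positivity, ?_⟩
  intro P c hP hc hc6 hcmin μ hμ U hU hU9 hUmin β hβmin hβc K hK L M _ _ hL3 hM3 d k hd hk1 hkN F hF N₀ hN0 hN
  have hβ : 0 < β := KLRegimeSplit.pos_of_klBetaMin_le hβmin
  obtain ⟨hc₁, hc₂, hc₃⟩ : c ≤ c₁' ∧ c ≤ c₂' ∧ c ≤ c₃' := by simp only [le_min_iff] at hcmin; exact ⟨hcmin.1, hcmin.2.1, hcmin.2.2⟩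
  obtain ⟨hU₁, hU₂, hU₃⟩ : U ≤ U₁' ∧ U ≤ U₂' ∧ U ≤ U₃' := by simp only [le_min_iff] at hUmin; exact ⟨hUmin.1, hUmin.2.1, hUmin.2.2⟩
  have hJ1 : 1 ≤ d * k - 1 := by have : 2 * 1 ≤ d * k := Nat.mul_le_mul hd hk1; omega
  set Φ : ℝ := (((d * k - 1 : ℕ) : ℝ) + 1) * ((2 : ℝ) ^ (d * k - 1)) ^ ((m + 1) - max F 1 - 2) with hΦ
  have hΦ0 : 0 ≤ Φ := by positivity
  set W : ℕ → ℝ := fun k' => if k' = 0 then C₀ * Φ * klTowerBornLev L M β U μ K d 0 (m + 1) F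
    else C * ((2 : ℝ) ^ (d * k - 1 - d * k')) ^ (m - F) * klTowerBornLev L M β U μ K d k' (m + 1) F with hW
  have hW0 : ∀ k' < k, 0 ≤ W k' := by
    intro k' _
    by_cases hk' : k' = 0
    · simp only [hW, hk', if_true]; exact mul_nonneg (by positivity) (klTowerBornLev_nonneg hβ.le U μ K d 0 (m + 1) F)
    · simp only [hW, hk', if_false]; exact mul_nonneg (by positivity) (klTowerBornLev_nonneg hβ.le U μ K d k' (m + 1) F)
  have hmain := klTowerMeasLev_le_of_summand_bounds (L := L) (M := M) hβ.le U μ K d k (m + 1) F (V₀ := Cuv * Φ * N₀) (W := W)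
    (by positivity) hW0
    (fun Ωe hlev => by
      have h := huv' P c hP hc hc6 hc₁ μ hμ U hU hU9 hU₁ β hβmin hβc K hK L M hL3 hM3 (d * k - 1) hJ1 hkN Ωe (by omega) N₀ hN0
        (fun Ωe' hlev' => hN Ωe' (hlev'.trans hlev))
      rw [hlev] at h
      calc _ ≤ Cuv * (((d * k - 1 : ℕ) : ℝ) + 1) * ((2 : ℝ) ^ (d * k - 1)) ^ ((m + 1) - max F 1 - 2) * N₀ := h
        _ = Cuv * Φ * N₀ := by rw [hΦ]; ring)
    (fun k' hk' Ωe hlev => by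
      by_cases hk'0 : k' = 0
      · subst hk'0
        have h := h0' P c hP hc hc6 hc₂ μ hμ U hU hU9 hU₂ β hβmin hβc K hK L M hL3 hM3 d k 0 hd hk' hkN Ωe (by omega)
        rw [hlev] at h
        calc _ ≤ C₀ * (((d * k - 1 : ℕ) : ℝ) + 1) * ((2 : ℝ) ^ (d * k - 1)) ^ ((m + 1) - max F 1 - 2) *
              klTowerBornLev L M β U μ K d 0 (m + 1) F := h
          _ = W 0 := by simp only [hW, if_true, hΦ]; ring
      · have h := hrel' P c hP hc hc6 hc₃ μ hμ U hU hU9 hU₃ β hβmin hβc K hK L M hL3 hM3 d k k' hd hk' hkN Ωe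
        rw [hlev] at h; simpa only [hW, hk'0, if_false] using h)
  have hsplit : ∑ k' ∈ range k, W k' = W 0 + ∑ k' ∈ Ico 1 k, W k' := by rw [range_eq_Ico]; exact sum_eq_sum_Ico_succ_bot hk1 W
  have hW0eq : W 0 = C₀ * Φ * klTowerBornLev L M β U μ K d 0 (m + 1) F := by simp [hW]
  have hWpos : ∑ k' ∈ Ico 1 k, W k' = ∑ k' ∈ Ico 1 k, C * ((2 : ℝ) ^ (d * k - 1 - d * k')) ^ (m - F) * klTowerBornLev L M β U μ K d k' (m + 1) F := by
    refine sum_congr rfl fun k' hk' => ?_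
    have hk'1 : k' ≠ 0 := by have := (mem_Ico.1 hk').1; omega
    simp [hW, hk'1]
  calc klTowerMeasLev L M β U μ K d k (m + 1) F ≤ Cuv * Φ * N₀ + ∑ k' ∈ range k, W k' := hmain
    _ = Cuv * (((d * k - 1 : ℕ) : ℝ) + 1) * ((2 : ℝ) ^ (d * k - 1)) ^ ((m + 1) - max F 1 - 2) * N₀ +
          (C₀ * (((d * k - 1 : ℕ) : ℝ) + 1) * ((2 : ℝ) ^ (d * k - 1)) ^ ((m + 1) - max F 1 - 2) * klTowerBornLev L M β U μ K d 0 (m + 1) F +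
            ∑ k' ∈ Ico 1 k, C * ((2 : ℝ) ^ (d * k - 1 - d * k')) ^ (m - F) * klTowerBornLev L M β U μ K d k' (m + 1) F) := by
        rw [hsplit, hW0eq, hWpos, hΦ]; ring

/-- **THE LEVELLED `hμ` ROW IN ABSOLUTE UNITS, relative rows throughout** (every level-count `F`; the one-determined-leg count for every summand, `𝒱_0` included):
`klTowerMeasLev … d k (m+1) F ≤ Cuv·(2^{dk−1})^{m−F}·N₀ + Σ_{k′<k} C·(2^{dk−1−dk′})^{m−F}·klTowerBornLev … d k′ (m+1) F` — the fallback for the cells with `≤ 2` free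
legs, where the second conservation gain is not available. [cite: BenfattoGiulianiMastropietro2006, §2.8 (2.76), (2.82)-(2.84), (2.93)-(2.98)] -/
theorem klTowerMeasLev_le_uv_add_sum_bornLev_klEng_lastLeg (m : ℕ) :
    ∃ Cuv : ℝ, 0 < Cuv ∧ ∃ C : ℝ, 0 < C ∧ ∀ R : RenConsts, R.WF2 → ∃ c₃' : ℝ, 0 < c₃' ∧ ∃ U₀' : ℝ, 0 < U₀' ∧
      ∀ (P : SplitConsts) (c : ℝ), P.WF → 0 < c → c ≤ klEngC₃6 P R → c ≤ c₃' →
      ∀ μ ∈ klWindowC, ∀ U : ℝ, 0 < U → U ≤ klEngU₀9 P R c → U ≤ U₀' → ∀ β : ℝ, klBetaMin ≤ β → β ≤ Real.exp (c / U ^ 2) →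
      ∀ K : TrigPolyC4v, FrameOK R U (nScales β) μ K → ∀ (L M : ℕ) [NeZero L] [NeZero M],
      klEngL₃ β U ≤ L → klEngM₃ β U L ≤ M → ∀ d k : ℕ, 2 ≤ d → 1 ≤ k → d * k - 1 ≤ nScales β + 1 →
      ∀ F : ℕ, ∀ N₀ : ℝ, 0 ≤ N₀ →
        (∀ Ωe' : Fin (m + 1) → Option (SectorLeg (sectorCount 0)), levelCount Ωe' = F →
          klAnisoLegKernelNormAt L M β U μ K klE0 0 (m + 1) Ωe' ≤ N₀) →
        klTowerMeasLev L M β U μ K d k (m + 1) F ≤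
          Cuv * ((2 : ℝ) ^ (d * k - 1)) ^ (m - F) * N₀ +
            ∑ k' ∈ range k, C * ((2 : ℝ) ^ (d * k - 1 - d * k')) ^ (m - F) * klTowerBornLev L M β U μ K d k' (m + 1) F := by
  obtain ⟨Cuv, hCuv, huv⟩ := klLevNormOf_scaleZero_remeasure_le_klEng m
  obtain ⟨C, hC, hrel⟩ := klLevNormOf_klTowerIncr_remeasure_le_klEng m
  refine ⟨Cuv, hCuv, C, hC, fun R hR2 => ?_⟩
  obtain ⟨c₁', hc₁', U₁', hU₁', huv'⟩ := huv R hR2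
  obtain ⟨c₃', hc₃', U₃', hU₃', hrel'⟩ := hrel R hR2
  refine ⟨min c₁' c₃', by positivity, min U₁' U₃', by positivity, ?_⟩
  intro P c hP hc hc6 hcmin μ hμ U hU hU9 hUmin β hβmin hβc K hK L M _ _ hL3 hM3 d k hd hk1 hkN F N₀ hN0 hN
  have hβ : 0 < β := KLRegimeSplit.pos_of_klBetaMin_le hβmin
  obtain ⟨hc₁, hc₃⟩ : c ≤ c₁' ∧ c ≤ c₃' := le_min_iff.1 hcmin
  obtain ⟨hU₁, hU₃⟩ : U ≤ U₁' ∧ U ≤ U₃' := le_min_iff.1 hUmin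
  have hJ1 : 1 ≤ d * k - 1 := by have : 2 * 1 ≤ d * k := Nat.mul_le_mul hd hk1; omega
  refine klTowerMeasLev_le_of_summand_bounds (L := L) (M := M) hβ.le U μ K d k (m + 1) F
    (W := fun k' => C * ((2 : ℝ) ^ (d * k - 1 - d * k')) ^ (m - F) * klTowerBornLev L M β U μ K d k' (m + 1) F)
    (by positivity) (fun k' _ => mul_nonneg (by positivity) (klTowerBornLev_nonneg hβ.le U μ K d k' (m + 1) F)) ?_ ?_
  · intro Ωe hlev
    have h := huv' P c hP hc hc6 hc₁ μ hμ U hU hU9 hU₁ β hβmin hβc K hK L M hL3 hM3 (d * k - 1) hJ1 hkN Ωe N₀ hN0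
      (fun Ωe' hlev' => hN Ωe' (hlev'.trans hlev))
    rw [hlev] at h; exact h
  · intro k' hk' Ωe hlev
    have h := hrel' P c hP hc hc6 hc₃ μ hμ U hU hU9 hU₃ β hβmin hβc K hK L M hL3 hM3 d k k' hd hk' hkN Ωe
    rw [hlev] at h; exact h

end Summit.HubbardSuperconductivity.HubbardSuperconductivity.Theorems.EngineV8

end
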